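import Literature.LinearAlgebra.Matrix.GL2ZSingularNormalForms
import HarnessLib

/-!
# Hertling–Larabi 2026b, the `2 × 2` classes with RATIONAL eigenvalues (types I, II, III of Def. 7.1 / Lemma 7.6):
# by the shift `B ↦ B − lE₂` (Rem. 7.5 (ii), §10.1) Theorem 9.4 and Theorem 10.3 (d) give unique representatives
# `(l₁ m; 0 l₂)`, `0 ≤ m ≤ ½|l₁ − l₂|` (eigenvalues `l₁ ≠ l₂`; `⌊|l₁ − l₂|/2⌋ + 1` classes) and `(l m; 0 l)`, `m ∈ ℕ₀`
# (double eigenvalue `l`; classes `↔ ℕ₀`)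

[topic LinearAlgebra/Matrix] Sequel to `GL2ZSingularNormalForms` (HL26b Thm. 9.4: classes with eigenvalues `λ ≠ 0`
and `0`; Thm. 10.3 (d): nilpotent classes) — REUSED by name (`existsUnique_conj_normalForm`, `natCard_quot_conj_eq`,
`existsUnique_conj_nilpotent_normalForm`, `conj_nilpotent_normalForm_ne_zero_iff`,
`exists_bijective_quot_conj_nilpotent`, `isNilpotent_iff_trace_eq_zero_and_det_eq_zero`).  With
`IntegerMatrixBinaryQuadraticForms` (types IV/V ↔ binary quadratic forms) this completes the tree's picture of the
`GL₂(ℤ)`-classes of integer `2 × 2` matrices whose characteristic polynomial splits over `ℚ`.  Lane `lit-hodgefound`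
(Track 2 foundations library), seat p19 generation 38, row g38-#9.  THEOREMS ONLY: no definition, no instance, no
notation, no named fact (D-0026, net Literature debt `0`), no `sorry`.

DEF-FREE SPELLING.  «characteristic polynomial `(t − l₁)(t − l₂)`» is `tr B = l₁ + l₂ ∧ det B = l₁l₂`;
«`(t − l)²`» is `tr B = 2l ∧ det B = l²`; `B ∼ B' :⟺ ∃ P ∈ M_{2×2}(ℤ), det P = ±1, PB = B'P` (HL Def. 6.1 (e)); class
sets are `Quot`s of the corresponding subtypes, counted by `Nat.card`.

## Source, VERBATIM

C. Hertling, K. Larabi, *Conjugacy classes of regular integer matrices*, arXiv:2602.15748 (2026) [HertlingLarabi2026b],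
held `paper:arxiv-2602.15748`.  §7.1 (chunk p0015), **Remarks 7.5** «(ii) We call a binary quadratic form of type
I, II, III, IV or V if some matrix which corresponds to it by Lemma 7.2 (b) is of the same type. This is possible as
the type of a matrix `B ∈ M_{2×2}(ℤ)` does not change if one adds a multiple of `E_2`.»; **Lemma 7.6** «(a) The
characteristic polynomial `p_B(t) = t² − rt + s ∈ ℤ[t]` satisfies `r = tr B = a + d`, `s = det B = ad − bc`. The
eigenvalues `λ_{1/2}` of `B` are `λ_{1/2} = r/2 ± √D` with `D = r²/4 − s` […] (b) `B` is of type I ⟺ `q = 0`. (c) `B`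
is of type II ⟺ `D = 0` and `q ≠ 0`. […] (d) `B` is of type III ⟺ `D > 0` and `4D ∈ ℕ` is a square.»  §10.1 (chunk
p0033): «An integer `n×n` matrix with a single Jordan block has one integer eigenvalue. We can restrict to the
eigenvalue `0`, so the nilpotent case, by subtracting the eigenvalue times the unit matrix from the given matrix.»
§9.2 (chunk p0029), **Theorem 9.4** «Each conjugacy class of `2×2` matrices with eigenvalues `λ ∈ ℕ` and `0` has a
unique representative `(λ μ; 0 0)` with `μ ∈ [0, ½λ] ∩ ℤ`.»  §10.2 (chunk p0034), **Theorem 10.3** «(d) Each conjugacy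
class of nilpotent `2×2` matrices `≠ 0` has a unique representative `(0 m; 0 0)` with `m ∈ ℕ`.»

## What is proved

* §1 `mul_sub_smul_one_eq_iff` (`PB = B'P ⟺ P(B − cE₂) = (B' − cE₂)P`: the shift commutes with conjugacy).
* §2 **Type III** (`l₁ ≠ l₂` integers, `tr B = l₁ + l₂`, `det B = l₁l₂`): `existsUnique_conj_splitNormalForm` — a unique
  representative `(l₁ m; 0 l₂)`, `0 ≤ m ≤ ½|l₁ − l₂|` — and `natCard_quot_conj_split_eq` — **`⌊|l₁ − l₂|/2⌋ + 1`
  classes** (the shift by `l₂E₂` is an equivalence of quotients onto Thm. 9.4's classes, `Quot.congr`).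
* §3 **Types I/II** (`tr B = 2l`, `det B = l²`): `existsUnique_conj_jordanNormalForm` — a unique representative
  `(l m; 0 l)`, `m ∈ ℕ₀` — `conj_jordanNormalForm_ne_zero_iff` (`m ≠ 0 ⟺ B ≠ lE₂`: type II vs. type I), and
  `exists_bijective_quot_conj_jordan` — **the classes are in bijection with `ℕ₀`**, `[(l m; 0 l)] ↦ m`.
NOT here: types IV/V (irreducible characteristic polynomial: `IntegerMatrixBinaryQuadraticForms`, HL §7.2–§8).

## References

* [HertlingLarabi2026b] C. Hertling, K. Larabi, *Conjugacy classes of regular integer matrices*, arXiv:2602.15748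
  (2026), §7.1 Def. 7.1, Rem. 7.5 (ii), Lemma 7.6 (a)–(d) (chunks p0014–p0015); §9.2 Thm. 9.4 (chunk p0029); §10.1
  and §10.2 Thm. 10.3 (d) (chunks p0033–p0034). [cite: HertlingLarabi2026b, §7.1 Rem. 7.5 (ii); §9.2 Thm. 9.4; §10.2
  Thm. 10.3 (d)]
-/

open Matrix

namespace Literature.LinearAlgebra.Matrix.GL2ZSingularNormalForm

/-! ## §1 «one adds a multiple of `E₂`»: conjugacy and the shift `B ↦ B − c·E₂` -/

/-- `PB = B'P ⟺ P(B − cE₂) = (B' − cE₂)P` (HL26b Rem. 7.5 (ii): the conjugacy class data «does not change if one adds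
a multiple of `E₂`»). [cite: HertlingLarabi2026b, §7.1 Remarks 7.5 (ii), chunk p0015] -/
theorem mul_sub_smul_one_eq_iff (P B B' : Matrix (Fin 2) (Fin 2) ℤ) (c : ℤ) :
    P * (B - c • (1 : Matrix (Fin 2) (Fin 2) ℤ)) = (B' - c • (1 : Matrix (Fin 2) (Fin 2) ℤ)) * P ↔
      P * B = B' * P := by
  rw [Matrix.mul_sub, Matrix.sub_mul, Matrix.mul_smul, Matrix.smul_mul, Matrix.mul_one, Matrix.one_mul,
    sub_left_inj]

/-- Trace and determinant of `B − cE₂` (`2 × 2`). [folklore] -/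
private theorem trace_det_sub_smul_one (B : Matrix (Fin 2) (Fin 2) ℤ) (c : ℤ) :
    (B - c • (1 : Matrix (Fin 2) (Fin 2) ℤ)).trace = B.trace - 2 * c ∧
      (B - c • (1 : Matrix (Fin 2) (Fin 2) ℤ)).det = B.det - c * B.trace + c ^ 2 := by
  have h00 : (B - c • (1 : Matrix (Fin 2) (Fin 2) ℤ)) 0 0 = B 0 0 - c := by
    rw [Matrix.sub_apply, Matrix.smul_apply, Matrix.one_apply_eq, smul_eq_mul, mul_one]
  have h11 : (B - c • (1 : Matrix (Fin 2) (Fin 2) ℤ)) 1 1 = B 1 1 - c := by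
    rw [Matrix.sub_apply, Matrix.smul_apply, Matrix.one_apply_eq, smul_eq_mul, mul_one]
  have h01 : (B - c • (1 : Matrix (Fin 2) (Fin 2) ℤ)) 0 1 = B 0 1 := by
    rw [Matrix.sub_apply, Matrix.smul_apply, Matrix.one_apply_ne (by decide), smul_zero, sub_zero]
  have h10 : (B - c • (1 : Matrix (Fin 2) (Fin 2) ℤ)) 1 0 = B 1 0 := by
    rw [Matrix.sub_apply, Matrix.smul_apply, Matrix.one_apply_ne (by decide), smul_zero, sub_zero]
  rw [Matrix.trace_fin_two, Matrix.det_fin_two, h00, h11, h01, h10, Matrix.trace_fin_two, Matrix.det_fin_two]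
  constructor <;> ring

/-- The shifted normal form: `(l₁ m; 0 l₂) − l₂E₂ = (l₁ − l₂, m; 0, 0)`. [folklore] -/
private theorem normalForm_sub_smul_one (l₁ l₂ m : ℤ) :
    (!![l₁, m; 0, l₂] : Matrix (Fin 2) (Fin 2) ℤ) - l₂ • (1 : Matrix (Fin 2) (Fin 2) ℤ) = !![l₁ - l₂, m; 0, 0] := by
  ext i j
  rw [Matrix.sub_apply, Matrix.smul_apply, smul_eq_mul]
  fin_cases i <;> fin_cases j
  · change l₁ - l₂ * (1 : Matrix (Fin 2) (Fin 2) ℤ) 0 0 = l₁ - l₂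
    rw [Matrix.one_apply_eq, mul_one]
  · change m - l₂ * (1 : Matrix (Fin 2) (Fin 2) ℤ) 0 1 = m
    rw [Matrix.one_apply_ne (by decide), mul_zero, sub_zero]
  · change 0 - l₂ * (1 : Matrix (Fin 2) (Fin 2) ℤ) 1 0 = 0
    rw [Matrix.one_apply_ne (by decide), mul_zero, sub_zero]
  · change l₂ - l₂ * (1 : Matrix (Fin 2) (Fin 2) ℤ) 1 1 = 0
    rw [Matrix.one_apply_eq, mul_one, sub_self]

/-- The shifted Jordan form: `(l m; 0 l) − lE₂ = (0 m; 0 0)`. [folklore] -/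
private theorem jordan_sub_smul_one (l m : ℤ) :
    (!![l, m; 0, l] : Matrix (Fin 2) (Fin 2) ℤ) - l • (1 : Matrix (Fin 2) (Fin 2) ℤ) = !![0, m; 0, 0] := by
  rw [normalForm_sub_smul_one, sub_self]

/-! ## §2 Type III: two distinct integer eigenvalues `l₁ ≠ l₂` — representatives `(l₁ m; 0 l₂)`, `0 ≤ m ≤ ½|l₁ − l₂|` -/

/-- **Two distinct integer eigenvalues (HL's type III; Thm. 9.4 after the shift by `l₂E₂`)**: an integer `2 × 2`
matrix with `tr B = l₁ + l₂`, `det B = l₁l₂`, `l₁ ≠ l₂` (characteristic polynomial `(t − l₁)(t − l₂)`) is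
`GL₂(ℤ)`-conjugate to `(l₁ m; 0 l₂)` for exactly one integer `m` with `0 ≤ m ≤ ½|l₁ − l₂|`.
[cite: HertlingLarabi2026b, §9.2 Theorem 9.4 (chunk p0029) with §7.1 Remarks 7.5 (ii) (chunk p0015)] -/
theorem existsUnique_conj_splitNormalForm {B : Matrix (Fin 2) (Fin 2) ℤ} {l₁ l₂ : ℤ} (hne : l₁ ≠ l₂)
    (htr : B.trace = l₁ + l₂) (hdet : B.det = l₁ * l₂) :
    ∃! m : ℕ, 2 * m ≤ (l₁ - l₂).natAbs ∧
      ∃ P : Matrix (Fin 2) (Fin 2) ℤ, IsUnit P.det ∧ P * B = !![l₁, (m : ℤ); 0, l₂] * P := by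
  obtain ⟨htr', hdet'⟩ := trace_det_sub_smul_one B l₂
  have ht : (B - l₂ • (1 : Matrix (Fin 2) (Fin 2) ℤ)).trace = l₁ - l₂ := by rw [htr', htr]; ring
  have hd : (B - l₂ • (1 : Matrix (Fin 2) (Fin 2) ℤ)).det = 0 := by rw [hdet', hdet, htr]; ring
  have ht0 : (B - l₂ • (1 : Matrix (Fin 2) (Fin 2) ℤ)).trace ≠ 0 := by rw [ht]; exact sub_ne_zero.2 hne
  obtain ⟨m, ⟨hm, hconj⟩, huniq⟩ := existsUnique_conj_normalForm hd ht0
  rw [ht] at hm hconj huniq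
  refine ⟨m, ⟨hm, ?_⟩, fun m' ⟨hm', hconj'⟩ => huniq m' ⟨hm', ?_⟩⟩
  · obtain ⟨P, hP, h⟩ := hconj
    refine ⟨P, hP, ?_⟩
    rwa [← normalForm_sub_smul_one, mul_sub_smul_one_eq_iff] at h
  · obtain ⟨P, hP, h⟩ := hconj'
    refine ⟨P, hP, ?_⟩
    rwa [← normalForm_sub_smul_one, mul_sub_smul_one_eq_iff]

/-- **Type III, counted**: for integers `l₁ ≠ l₂` the `GL₂(ℤ)`-classes of integer `2 × 2` matrices with
characteristic polynomial `(t − l₁)(t − l₂)` number `⌊|l₁ − l₂|/2⌋ + 1` (the shift `B ↦ B − l₂E₂` is a bijection onto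
the classes with eigenvalues `l₁ − l₂` and `0`, `GL2ZSingularNormalForms.natCard_quot_conj_eq`).
[cite: HertlingLarabi2026b, §9.2 Theorem 9.4 (chunk p0029) with §7.1 Remarks 7.5 (ii) (chunk p0015)] -/
theorem natCard_quot_conj_split_eq {l₁ l₂ : ℤ} (hne : l₁ ≠ l₂) :
    Nat.card (Quot fun B B' : {B : Matrix (Fin 2) (Fin 2) ℤ // B.trace = l₁ + l₂ ∧ B.det = l₁ * l₂} =>
      ∃ P : Matrix (Fin 2) (Fin 2) ℤ, IsUnit P.det ∧ P * B.1 = B'.1 * P) = (l₁ - l₂).natAbs / 2 + 1 := by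
  rw [← natCard_quot_conj_eq (sub_ne_zero.2 hne)]
  apply Nat.card_congr
  refine Quot.congr
    { toFun := fun B => ⟨B.1 - l₂ • (1 : Matrix (Fin 2) (Fin 2) ℤ), by
        obtain ⟨htr', hdet'⟩ := trace_det_sub_smul_one B.1 l₂
        refine ⟨by rw [htr', B.2.1]; ring, by rw [hdet', B.2.2, B.2.1]; ring⟩⟩
      invFun := fun B => ⟨B.1 + l₂ • (1 : Matrix (Fin 2) (Fin 2) ℤ), by
        obtain ⟨htr', hdet'⟩ := trace_det_sub_smul_one (B.1 + l₂ • (1 : Matrix (Fin 2) (Fin 2) ℤ)) l₂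
        rw [add_sub_cancel_right] at htr' hdet'
        rw [B.2.1] at htr'
        rw [B.2.2] at hdet'
        refine ⟨by linear_combination -htr', ?_⟩
        have htr2 : (B.1 + l₂ • (1 : Matrix (Fin 2) (Fin 2) ℤ)).trace = l₁ + l₂ := by linear_combination -htr'
        rw [htr2] at hdet'
        linear_combination -hdet'⟩
      left_inv := fun B => Subtype.ext (sub_add_cancel _ _)
      right_inv := fun B => Subtype.ext (add_sub_cancel_right _ _) } ?_
  intro B B'
  simp only [Equiv.coe_fn_mk]
  constructor
  · rintro ⟨P, hP, h⟩
    exact ⟨P, hP, (mul_sub_smul_one_eq_iff P _ _ l₂).2 h⟩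
  · rintro ⟨P, hP, h⟩
    exact ⟨P, hP, (mul_sub_smul_one_eq_iff P _ _ l₂).1 h⟩

/-! ## §3 Type II: one Jordan block with integer eigenvalue `l` — representatives `(l m; 0 l)`, `m ∈ ℕ` -/

/-- **A double integer eigenvalue (HL's types I/II; Thm. 10.3 (d) after the shift by `lE₂`, §10.1: «We can restrict to
the eigenvalue `0`, so the nilpotent case, by subtracting the eigenvalue times the unit matrix»)**: an integer
`2 × 2` matrix with `tr B = 2l`, `det B = l²` (characteristic polynomial `(t − l)²`) is `GL₂(ℤ)`-conjugate to
`(l m; 0 l)` for exactly one `m ∈ ℕ₀`; `m = 0` iff `B = lE₂` (type I).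
[cite: HertlingLarabi2026b, §10.1 (chunk p0033) and §10.2 Theorem 10.3 (d) (chunk p0034)] -/
theorem existsUnique_conj_jordanNormalForm {B : Matrix (Fin 2) (Fin 2) ℤ} {l : ℤ} (htr : B.trace = 2 * l)
    (hdet : B.det = l ^ 2) :
    ∃! m : ℕ, ∃ P : Matrix (Fin 2) (Fin 2) ℤ, IsUnit P.det ∧ P * B = !![l, (m : ℤ); 0, l] * P := by
  obtain ⟨htr', hdet'⟩ := trace_det_sub_smul_one B l
  have ht : (B - l • (1 : Matrix (Fin 2) (Fin 2) ℤ)).trace = 0 := by rw [htr', htr]; ring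
  have hd : (B - l • (1 : Matrix (Fin 2) (Fin 2) ℤ)).det = 0 := by rw [hdet', hdet, htr]; ring
  have hnil : IsNilpotent (B - l • (1 : Matrix (Fin 2) (Fin 2) ℤ)) :=
    (isNilpotent_iff_trace_eq_zero_and_det_eq_zero _).2 ⟨ht, hd⟩
  obtain ⟨m, hconj, huniq⟩ := existsUnique_conj_nilpotent_normalForm hnil
  refine ⟨m, ?_, fun m' hconj' => huniq m' ?_⟩
  · obtain ⟨P, hP, h⟩ := hconj
    refine ⟨P, hP, ?_⟩
    rwa [← jordan_sub_smul_one l m, mul_sub_smul_one_eq_iff] at h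
  · obtain ⟨P, hP, h⟩ := hconj'
    refine ⟨P, hP, ?_⟩
    rwa [← jordan_sub_smul_one l m', mul_sub_smul_one_eq_iff]

/-- The representative `(l m; 0 l)` has `m ≠ 0` iff `B` is not the scalar matrix `lE₂` (type II versus type I).
[cite: HertlingLarabi2026b, §10.2 Theorem 10.3 (d) (chunk p0034), §7.1 Lemma 7.6 (b)–(c) (chunk p0015)] -/
theorem conj_jordanNormalForm_ne_zero_iff {B : Matrix (Fin 2) (Fin 2) ℤ} {l : ℤ} {m : ℕ}
    (h : ∃ P : Matrix (Fin 2) (Fin 2) ℤ, IsUnit P.det ∧ P * B = !![l, (m : ℤ); 0, l] * P) :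
    m ≠ 0 ↔ B ≠ l • (1 : Matrix (Fin 2) (Fin 2) ℤ) := by
  obtain ⟨P, hP, hPB⟩ := h
  have h' : ∃ P : Matrix (Fin 2) (Fin 2) ℤ, IsUnit P.det ∧
      P * (B - l • (1 : Matrix (Fin 2) (Fin 2) ℤ)) = !![0, (m : ℤ); 0, 0] * P :=
    ⟨P, hP, by rw [← jordan_sub_smul_one l m, mul_sub_smul_one_eq_iff]; exact hPB⟩
  rw [conj_nilpotent_normalForm_ne_zero_iff h', Ne, sub_eq_zero]

/-- **Types I/II, counted**: the `GL₂(ℤ)`-classes of integer `2 × 2` matrices with characteristic polynomial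
`(t − l)²` are in bijection with `ℕ₀` (`[(l m; 0 l)] ↦ m`; infinitely many classes — HL26b Rem. 6.3 (iv)–(v) for
`f = (t − l)²`). [cite: HertlingLarabi2026b, §10.1 (chunk p0033), §10.2 Theorem 10.3 (d) (chunk p0034)] -/
theorem exists_bijective_quot_conj_jordan (l : ℤ) :
    ∃ F : (Quot fun B B' : {B : Matrix (Fin 2) (Fin 2) ℤ // B.trace = 2 * l ∧ B.det = l ^ 2} =>
      ∃ P : Matrix (Fin 2) (Fin 2) ℤ, IsUnit P.det ∧ P * B.1 = B'.1 * P) → ℕ,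
      Function.Bijective F ∧ ∀ m : ℕ, ∀ h, F (Quot.mk _ ⟨!![l, (m : ℤ); 0, l], h⟩) = m := by
  obtain ⟨F, hF, hFm⟩ := exists_bijective_quot_conj_nilpotent
  -- the shift `B ↦ B − lE₂` as an equivalence of the two quotients, computed on representatives
  have hto : ∀ B : {B : Matrix (Fin 2) (Fin 2) ℤ // B.trace = 2 * l ∧ B.det = l ^ 2},
      IsNilpotent (B.1 - l • (1 : Matrix (Fin 2) (Fin 2) ℤ)) := fun B => by
    obtain ⟨htr', hdet'⟩ := trace_det_sub_smul_one B.1 l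
    rw [isNilpotent_iff_trace_eq_zero_and_det_eq_zero]
    refine ⟨by rw [htr', B.2.1]; ring, by rw [hdet', B.2.2, B.2.1]; ring⟩
  have hinv : ∀ N : {N : Matrix (Fin 2) (Fin 2) ℤ // IsNilpotent N},
      (N.1 + l • (1 : Matrix (Fin 2) (Fin 2) ℤ)).trace = 2 * l ∧ (N.1 + l • (1 : Matrix (Fin 2) (Fin 2) ℤ)).det = l ^ 2 :=
    fun N => by
    obtain ⟨htr', hdet'⟩ := trace_det_sub_smul_one (N.1 + l • (1 : Matrix (Fin 2) (Fin 2) ℤ)) l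
    obtain ⟨ht0, hd0⟩ := (isNilpotent_iff_trace_eq_zero_and_det_eq_zero _).1 N.2
    rw [add_sub_cancel_right] at htr' hdet'
    rw [ht0] at htr'
    rw [hd0] at hdet'
    have htr2 : (N.1 + l • (1 : Matrix (Fin 2) (Fin 2) ℤ)).trace = 2 * l := by linear_combination -htr'
    refine ⟨htr2, ?_⟩
    rw [htr2] at hdet'
    linear_combination -hdet'
  obtain ⟨e, he⟩ : ∃ e : (Quot fun B B' : {B : Matrix (Fin 2) (Fin 2) ℤ // B.trace = 2 * l ∧ B.det = l ^ 2} =>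
      ∃ P : Matrix (Fin 2) (Fin 2) ℤ, IsUnit P.det ∧ P * B.1 = B'.1 * P) ≃
      (Quot fun N N' : {N : Matrix (Fin 2) (Fin 2) ℤ // IsNilpotent N} =>
        ∃ P : Matrix (Fin 2) (Fin 2) ℤ, IsUnit P.det ∧ P * N.1 = N'.1 * P),
      ∀ B h, e (Quot.mk _ ⟨B, h⟩) = Quot.mk _ ⟨B - l • (1 : Matrix (Fin 2) (Fin 2) ℤ), hto ⟨B, h⟩⟩ :=
    ⟨Quot.congr
      { toFun := fun B => ⟨B.1 - l • (1 : Matrix (Fin 2) (Fin 2) ℤ), hto B⟩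
        invFun := fun N => ⟨N.1 + l • (1 : Matrix (Fin 2) (Fin 2) ℤ), hinv N⟩
        left_inv := fun B => Subtype.ext (sub_add_cancel _ _)
        right_inv := fun N => Subtype.ext (add_sub_cancel_right _ _) }
      (fun B B' => ⟨fun ⟨P, hP, h⟩ => ⟨P, hP, (mul_sub_smul_one_eq_iff P _ _ l).2 h⟩,
        fun ⟨P, hP, h⟩ => ⟨P, hP, (mul_sub_smul_one_eq_iff P _ _ l).1 h⟩⟩),
      fun B h => rfl⟩
  refine ⟨F ∘ e, hF.comp e.bijective, fun m h => ?_⟩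
  have hnil : IsNilpotent (!![0, (m : ℤ); 0, 0] : Matrix (Fin 2) (Fin 2) ℤ) := by
    rw [isNilpotent_iff_trace_eq_zero_and_det_eq_zero, Matrix.trace_fin_two_of, Matrix.det_fin_two_of]
    constructor <;> ring
  have hmk : (⟨!![l, (m : ℤ); 0, l] - l • (1 : Matrix (Fin 2) (Fin 2) ℤ), hto ⟨_, h⟩⟩ :
      {N : Matrix (Fin 2) (Fin 2) ℤ // IsNilpotent N}) = ⟨!![0, (m : ℤ); 0, 0], hnil⟩ :=
    Subtype.ext (jordan_sub_smul_one l m)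
  rw [Function.comp_apply, he, hmk, hFm]

end Literature.LinearAlgebra.Matrix.GL2ZSingularNormalForm
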